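import Mathlib.Algebra.MvPolynomial.Basic
import Mathlib.RingTheory.MvPolynomial.Basic
import Mathlib.Order.BooleanSubalgebra
import Mathlib.Algebra.Order.Ring.Defs
import Mathlib.FieldTheory.IsRealClosed.Basic
import Mathlib.MeasureTheory.Constructions.BorelSpace.Basic
import Mathlib.MeasureTheory.Constructions.BorelSpace.Real
import Mathlib.Data.Real.Basic
import HarnessLib

-- provenance: harness21/H21/H21/Prelude/TranscendEllArithS/Semialgebraic.lean @ bc880d9 (interim HEAD d8f2665); M5 mechanical rewrite
/-!
# Semialgebraic sets over a coefficient ring (trunk T-TRANSCEND / G06, outline C1)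

A subset of `R ^ ι` (here `ι → R`, `R` an ordered commutative ring) is *`k`-semialgebraic* if it
belongs to the Boolean algebra of sets generated by the sets `{x | p(x) = 0}` and `{x | p(x) > 0}`
for `p ∈ k[Xᵢ : i ∈ ι]`, the polynomial being evaluated through the algebra map `k → R`.
The case of interest for Kontsevich–Zagier periods is `k = ℚ` (equivalently `ℤ`, or `ℚ̄ ∩ ℝ`),
`R = ℝ`, `ι = Fin n`.

## Main definitions

* `Literature.semialgebraicSets k R ι : BooleanSubalgebra (Set (ι → R))` — the Boolean subalgebra generated
  by polynomial zero sets and strict-positivity sets with coefficients in `k`.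
* `Literature.IsSemialgebraic k s` — membership in `semialgebraicSets`.
* `Literature.IsBasicSemialgebraic k s` — `s = {x | p₁(x) = ⋯ = pₐ(x) = 0, q₁(x) > 0, …, q_b(x) > 0}`.

## Main statements (proofs deferred)

* `Literature.ModelTheory.ExponentialFields.isSemialgebraic_iff_exists_finset_basic` — every semialgebraic set is a finite union of
  basic ones (Bochnak–Coste–Roy, Prop. 2.1.8).
* `Literature.ModelTheory.ExponentialFields.tarski_seidenberg` — over a real closed field, coordinate projections of semialgebraic sets
  are semialgebraic (Bochnak–Coste–Roy, Thm. 2.2.1); `Literature.ModelTheory.ExponentialFields.tarski_seidenberg_real` is the case `R = ℝ`.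
* `Literature.ModelTheory.ExponentialFields.IsSemialgebraic.measurableSet` — real semialgebraic sets are Borel.

## References

* M. Kontsevich, D. Zagier, *Periods* (2001), §1.1.
* J. Bochnak, M. Coste, M.-F. Roy, *Real Algebraic Geometry* (1998), Def. 2.1.4, Prop. 2.1.8,
  Thm. 2.2.1.

## Design notes

* Mathlib (searched: `emialgebraic`, `BooleanSubalgebra`, `IsRealClosed`) has no notion of
  semialgebraic set; we use the direct route via `BooleanSubalgebra.closure` and
  `MvPolynomial.aeval`, with no model theory imported (the first-order/definability link is stated
  in the outline item C8).
* The definitions only need `[LT R]`; lemmas about `≤`, `≠` and normal forms assume the order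
  structure they need (`PartialOrder`, resp. `LinearOrder` + `IsStrictOrderedRing`).
* Mathlib has no `IsRealClosed ℝ` instance at the pinned commit, so the real case of
  Tarski–Seidenberg is stated separately.
-/

noncomputable section

open Set MvPolynomial

namespace Literature.ModelTheory.ExponentialFields

section Defs

variable (k : Type*) {R : Type*} (ι : Type*) [CommRing k] [CommRing R] [LT R] [Algebra k R]

/-- The Boolean algebra of `k`-semialgebraic subsets of `ι → R`: the Boolean subalgebra of
`Set (ι → R)` generated by the zero sets `{x | aeval x p = 0}` and the strict positivity sets
`{x | 0 < aeval x p}` of polynomials `p : MvPolynomial ι k`.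
[Bochnak–Coste–Roy 1998, Def. 2.1.4; Kontsevich–Zagier 2001, §1.1] [cite: BochnakCosteRoy1998, Def. 2.1.4] -/
def semialgebraicSets (R : Type*) [CommRing R] [LT R] [Algebra k R] :
    BooleanSubalgebra (Set (ι → R)) :=
  BooleanSubalgebra.closure
    (range (fun p : MvPolynomial ι k => {x : ι → R | aeval x p = 0}) ∪
      range (fun p : MvPolynomial ι k => {x : ι → R | 0 < aeval x p}))

variable {ι}

/-- A set `s ⊆ (ι → R)` is `k`-semialgebraic if it lies in the Boolean algebra generated by
polynomial equalities `p(x) = 0` and strict inequalities `p(x) > 0` with `p ∈ k[Xᵢ]`.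
[Bochnak–Coste–Roy 1998, Def. 2.1.4; Kontsevich–Zagier 2001, §1.1 (with `k = ℚ`, `R = ℝ`)] [cite: BochnakCosteRoy1998, Def. 2.1.4] -/
def IsSemialgebraic (s : Set (ι → R)) : Prop :=
  s ∈ semialgebraicSets k ι R

/-- A set `s ⊆ (ι → R)` is *basic* `k`-semialgebraic if it is cut out by finitely many polynomial
equations and finitely many strict polynomial inequalities with coefficients in `k`:
`s = {x | ∀ p ∈ E, p(x) = 0} ∩ {x | ∀ q ∈ P, q(x) > 0}`.
[Bochnak–Coste–Roy 1998, Prop. 2.1.8] [cite: BochnakCosteRoy1998, Prop. 2.1.8] -/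
def IsBasicSemialgebraic (s : Set (ι → R)) : Prop :=
  ∃ E P : Finset (MvPolynomial ι k),
    s = {x | (∀ p ∈ E, aeval x p = 0) ∧ ∀ q ∈ P, 0 < aeval x q}

variable {k}

/-- Zero sets of polynomials over `k` are `k`-semialgebraic. [BCR 1998, Def. 2.1.4] [cite: BCR1998, Def. 2.1.4] -/
theorem isSemialgebraic_setOf_eval_eq_zero (p : MvPolynomial ι k) :
    IsSemialgebraic k {x : ι → R | aeval x p = 0} :=
  BooleanSubalgebra.subset_closure (Or.inl ⟨p, rfl⟩)

/-- Strict positivity sets of polynomials over `k` are `k`-semialgebraic. [BCR 1998, Def. 2.1.4] [cite: BCR1998, Def. 2.1.4] -/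
theorem isSemialgebraic_setOf_eval_pos (p : MvPolynomial ι k) :
    IsSemialgebraic k {x : ι → R | 0 < aeval x p} :=
  BooleanSubalgebra.subset_closure (Or.inr ⟨p, rfl⟩)

/-- The empty set is semialgebraic. [BCR 1998, §2.1] [cite: BCR1998, §2.1] -/
@[simp] theorem isSemialgebraic_empty : IsSemialgebraic k (∅ : Set (ι → R)) :=
  BooleanSubalgebra.bot_mem

/-- The whole space is semialgebraic. [BCR 1998, §2.1] [cite: BCR1998, §2.1] -/
@[simp] theorem isSemialgebraic_univ : IsSemialgebraic k (univ : Set (ι → R)) :=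
  BooleanSubalgebra.top_mem

namespace IsSemialgebraic

variable {s t : Set (ι → R)}

/-- Semialgebraic sets are closed under union. [BCR 1998, §2.1] [cite: BCR1998, §2.1] -/
theorem union (hs : IsSemialgebraic k s) (ht : IsSemialgebraic k t) : IsSemialgebraic k (s ∪ t) :=
  BooleanSubalgebra.sup_mem hs ht

/-- Semialgebraic sets are closed under intersection. [BCR 1998, §2.1] [cite: BCR1998, §2.1] -/
theorem inter (hs : IsSemialgebraic k s) (ht : IsSemialgebraic k t) : IsSemialgebraic k (s ∩ t) :=
  BooleanSubalgebra.inf_mem hs ht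

/-- Semialgebraic sets are closed under complement. [BCR 1998, §2.1] [cite: BCR1998, §2.1] -/
theorem compl (hs : IsSemialgebraic k s) : IsSemialgebraic k sᶜ :=
  BooleanSubalgebra.compl_mem hs

/-- Semialgebraic sets are closed under set difference. [BCR 1998, §2.1] [cite: BCR1998, §2.1] -/
theorem diff (hs : IsSemialgebraic k s) (ht : IsSemialgebraic k t) : IsSemialgebraic k (s \ t) :=
  BooleanSubalgebra.sdiff_mem hs ht

/-- Finite unions of semialgebraic sets are semialgebraic. [BCR 1998, §2.1] [cite: BCR1998, §2.1] -/
theorem biUnion {α : Type*} (S : Finset α) (f : α → Set (ι → R))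
    (hf : ∀ a ∈ S, IsSemialgebraic k (f a)) : IsSemialgebraic k (⋃ a ∈ S, f a) := by
  classical
  induction S using Finset.induction_on with
  | empty => simp
  | insert a S ha ih =>
    rw [Finset.set_biUnion_insert]
    exact (hf a (Finset.mem_insert_self a S)).union
      (ih fun b hb => hf b (Finset.mem_insert_of_mem hb))

/-- Finite intersections of semialgebraic sets are semialgebraic. [BCR 1998, §2.1] [cite: BCR1998, §2.1] -/
theorem biInter {α : Type*} (S : Finset α) (f : α → Set (ι → R))
    (hf : ∀ a ∈ S, IsSemialgebraic k (f a)) : IsSemialgebraic k (⋂ a ∈ S, f a) := by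
  classical
  induction S using Finset.induction_on with
  | empty => simp
  | insert a S ha ih =>
    rw [Finset.set_biInter_insert]
    exact (hf a (Finset.mem_insert_self a S)).inter
      (ih fun b hb => hf b (Finset.mem_insert_of_mem hb))

end IsSemialgebraic

/-- Non-vanishing sets `{x | p(x) ≠ 0}` are semialgebraic. [BCR 1998, §2.1] [cite: BCR1998, §2.1] -/
theorem isSemialgebraic_setOf_eval_ne_zero (p : MvPolynomial ι k) :
    IsSemialgebraic k {x : ι → R | aeval x p ≠ 0} :=
  (isSemialgebraic_setOf_eval_eq_zero p).compl

/-- A basic semialgebraic set is semialgebraic. [BCR 1998, Prop. 2.1.8] [cite: BCR1998, Prop. 2.1.8] -/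
theorem IsBasicSemialgebraic.isSemialgebraic {s : Set (ι → R)} (hs : IsBasicSemialgebraic k s) :
    IsSemialgebraic k s := by
  obtain ⟨E, P, rfl⟩ := hs
  have h1 : IsSemialgebraic k (⋂ p ∈ E, {x : ι → R | aeval x p = 0}) :=
    IsSemialgebraic.biInter E _ fun p _ => isSemialgebraic_setOf_eval_eq_zero p
  have h2 : IsSemialgebraic k (⋂ q ∈ P, {x : ι → R | 0 < aeval x q}) :=
    IsSemialgebraic.biInter P _ fun q _ => isSemialgebraic_setOf_eval_pos q
  convert h1.inter h2 using 1
  ext x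
  simp

/-- Products of semialgebraic sets are semialgebraic: if `s ⊆ R ^ m` and `t ⊆ R ^ n` are
`k`-semialgebraic then so is `s × t ⊆ R ^ (m + n)`, realised via `Fin.append`.
[BCR 1998, §2.1] [cite: BCR1998, §2.1] -/
def IsSemialgebraic.prod : Prop :=
  ∀ {m n : ℕ} {s : Set (Fin m → R)} {t : Set (Fin n → R)} (hs : IsSemialgebraic k s) (ht : IsSemialgebraic k t),
    IsSemialgebraic k (image2 Fin.append s t : Set (Fin (m + n) → R))

end Defs

section PartialOrder

variable {k : Type*} {R : Type*} {ι : Type*} [CommRing k] [CommRing R] [PartialOrder R]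
  [Algebra k R]

/-- Non-strict positivity sets `{x | 0 ≤ p(x)} = {x | 0 < p(x)} ∪ {x | p(x) = 0}` are
semialgebraic. [BCR 1998, §2.1] [cite: BCR1998, §2.1] -/
theorem isSemialgebraic_setOf_eval_nonneg (p : MvPolynomial ι k) :
    IsSemialgebraic k {x : ι → R | 0 ≤ aeval x p} := by
  convert (isSemialgebraic_setOf_eval_pos p).union (isSemialgebraic_setOf_eval_eq_zero (R := R) p)
    using 1
  ext x
  simp only [mem_setOf_eq, mem_union, le_iff_lt_or_eq, eq_comm]

/-- Sets `{x | p(x) ≤ q(x)}` defined by a non-strict polynomial inequality are semialgebraic.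
[BCR 1998, §2.1] [cite: BCR1998, §2.1] -/
theorem isSemialgebraic_setOf_eval_le [IsOrderedAddMonoid R] (p q : MvPolynomial ι k) :
    IsSemialgebraic k {x : ι → R | aeval x p ≤ aeval x q} := by
  convert isSemialgebraic_setOf_eval_nonneg (R := R) (q - p) using 2 with x
  simp only [map_sub, sub_nonneg]

/-- Sets `{x | p(x) < q(x)}` defined by a strict polynomial inequality are semialgebraic.
[BCR 1998, §2.1] [cite: BCR1998, §2.1] -/
theorem isSemialgebraic_setOf_eval_lt [IsOrderedAddMonoid R] (p q : MvPolynomial ι k) :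
    IsSemialgebraic k {x : ι → R | aeval x p < aeval x q} := by
  convert isSemialgebraic_setOf_eval_pos (R := R) (q - p) using 2 with x
  simp only [map_sub, sub_pos]

end PartialOrder

section LinearOrder

variable {k : Type*} {R : Type*} {ι : Type*} [CommRing k] [CommRing R] [LinearOrder R]
  [IsStrictOrderedRing R] [Algebra k R]

-- Binder repair (2026-08-16): the header instance deliberately shadows the section's, which a
-- `def` does not capture (it ranged too widely before); the overlapping-instances linter is moot.
set_option linter.overlappingInstances false in
/-- **Normal form.** Over a linearly ordered ring, a set is `k`-semialgebraic iff it is a finite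
union of basic `k`-semialgebraic sets `{x | p₁(x) = ⋯ = pₐ(x) = 0, q₁(x) > 0, …, q_b(x) > 0}`.
[Bochnak–Coste–Roy 1998, Prop. 2.1.8] [cite: BochnakCosteRoy1998, Prop. 2.1.8]
(Binder repair 2026-08-16: `[IsStrictOrderedRing R]` is written in the header so that it is a
parameter of the elaborated constant; as a section instance unused by the body it was silently
dropped, so the fact ranged over cases the printed theorem excludes.) -/
def isSemialgebraic_iff_exists_finset_basic [IsStrictOrderedRing R] : Prop :=
  ∀ (s : Set (ι → R)),
    IsSemialgebraic k s ↔
      ∃ S : Finset (Set (ι → R)), (∀ t ∈ S, IsBasicSemialgebraic k t) ∧ s = ⋃ t ∈ S, t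

end LinearOrder

section RealClosed

variable {k : Type*} {R : Type*} [CommRing k] [Field R] [LinearOrder R] [IsStrictOrderedRing R]
  [IsRealClosed R] [Algebra k R]

/-- **Tarski–Seidenberg theorem** (projection form). Over a real closed field `R`, the image of a
`k`-semialgebraic subset of `R ^ (n + 1)` under the projection forgetting the last coordinate is a
`k`-semialgebraic subset of `R ^ n`.
[Bochnak–Coste–Roy 1998, Thm. 2.2.1; Tarski 1951, Seidenberg 1954] [cite: BochnakCosteRoy1998, Thm. 2.2.1] -/
def tarski_seidenberg : Prop :=
  ∀ {n : ℕ} {s : Set (Fin (n + 1) → R)} (hs : IsSemialgebraic k s),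
    IsSemialgebraic k ((fun x : Fin (n + 1) → R => x ∘ Fin.castSucc) '' s)

end RealClosed

section Real

variable {k : Type*} [CommRing k] [Algebra k ℝ]

/-- **Tarski–Seidenberg theorem** over `ℝ` (projection form): the image of a `k`-semialgebraic
subset of `ℝ ^ (n + 1)` under the projection forgetting the last coordinate is `k`-semialgebraic.
Stated separately because Mathlib has no `IsRealClosed ℝ` instance at the pinned commit.
[Bochnak–Coste–Roy 1998, Thm. 2.2.1] [cite: BochnakCosteRoy1998, Thm. 2.2.1] -/
def tarski_seidenberg_real : Prop :=
  ∀ {n : ℕ} {s : Set (Fin (n + 1) → ℝ)} (hs : IsSemialgebraic k s),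
    IsSemialgebraic k ((fun x : Fin (n + 1) → ℝ => x ∘ Fin.castSucc) '' s)

/-- Real semialgebraic sets are Borel measurable (they are finite Boolean combinations of
preimages of `{0}` and `(0, ∞)` under polynomial, hence continuous, maps).
[BCR 1998, §2.1; Kontsevich–Zagier 2001, §1.1] [cite: BCR1998, §2.1] -/
def IsSemialgebraic.measurableSet : Prop :=
  ∀ {ι : Type*} {s : Set (ι → ℝ)} (hs : IsSemialgebraic k s),
    MeasurableSet s

end Real

end Literature.ModelTheory.ExponentialFields

namespace Literature.ModelTheory.ExponentialFields

section RealProofs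

variable {k : Type*} [CommRing k] [Algebra k ℝ]

/-- Polynomial functions `x ↦ p(x)` on `ι → ℝ` (any index type `ι`) are measurable for the product
`σ`-algebra: induction on `p`, coordinates being measurable. [folklore] -/
theorem measurable_aeval_real {ι : Type*} (p : MvPolynomial ι k) :
    Measurable fun x : ι → ℝ => aeval x p := by
  induction p using MvPolynomial.induction_on with
  | C a => simp
  | add p q hp hq => simpa using hp.fun_add hq
  | mul_X p i hp => simpa using hp.fun_mul (measurable_pi_apply i)

/-- Discharge of the named fact `Literature.ModelTheory.ExponentialFields.IsSemialgebraic.measurableSet`: real semialgebraic sets are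
measurable, by induction over the generating Boolean combinations, the generators
`{x | p(x) = 0}` and `{x | 0 < p(x)}` being preimages of Borel sets under measurable polynomial maps.
[BCR 1998, §2.1] [cite: BCR1998, §2.1] -/
theorem IsSemialgebraic.measurableSet_holds : IsSemialgebraic.measurableSet (k := k) := by
  intro ι s hs
  induction hs using BooleanSubalgebra.closure_bot_sup_induction with
  | mem s hs =>
    rcases hs with ⟨p, rfl⟩ | ⟨p, rfl⟩
    · exact (measurable_aeval_real p) (measurableSet_singleton 0)
    · exact (measurable_aeval_real p) measurableSet_Ioi
  | bot => exact MeasurableSet.empty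
  | sup s _ t _ hs ht => exact hs.union ht
  | compl s _ hs => exact hs.compl

end RealProofs

end Literature.ModelTheory.ExponentialFields
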